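import Literature.AlgebraicGeometry.Motives.PeriodComparison
import Literature.AlgebraicGeometry.Motives.BettiHodgeClassicalPin
import Literature.AlgebraicGeometry.HodgeTheory.HodgeConjecture
import Literature.AlgebraicGeometry.HodgeTheory.HodgeFiltration
import HarnessLib

/-!
# The classical core of a Betti–Hodge datum / period realization (light-weight hypothesis predicate)

`BettiHodgeData ℂ` (`Motives/BettiRealization`) and `PeriodRealization k` (`Motives/PeriodComparison`)
are HYPOTHESIS STRUCTURES standing in for the classical Betti–Hodge realization and Grothendieck's
de Rham–Betti comparison; their axioms do not determine the data (the tree records exotic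
re-decorations `BettiHodgeData.weil`, `.pureEven`, `.conjugate`), so every bridge between the abstract
layer (`B.hodge`, `B.HodgeConjectureFor`, …) and the real carriers of
`Literature/AlgebraicGeometry/HodgeTheory` (singular cohomology of the complex points, Hodge models,
`HodgeTheory.HodgeConjectureFor`) is stated under a hypothesis predicate tying the datum to the
classical one. The full predicate `BettiHodgeData.IsClassical` (`Motives/PeriodRealizationClassical`,
v1 = (i)/(i') Hodge-structure pin + (ii-a) supports of cycle classes + (ii-b) fundamental-class data)
lives in a module whose import cone — `HodgeTheory/RealStructureSingular` (real structure and complex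
conjugation of singular cohomology, the Hodge-decomposition files) for the change of coefficients
`ofRatClass`, and `Motives/BettiCycleClass` (algebraic equivalence, subscheme cycles) for clause
(ii-b) — carries fifteen unproved named facts, none of which is a dependency of clauses (i), (i'),
(ii-a) or of the bridge to `HodgeTheory.HodgeConjectureFor`. This file (definition request
`defn-BettiHodgeData.IsClassicalCore`, route `HodgeConjecture/AdelicCoherence`, 2026-08-15 cone
repair; pure re-homing, no new mathematics) is the LIGHT-WEIGHT home of exactly those three clauses
and of the bridge: it imports only `Motives/PeriodComparison`, `Motives/BettiHodgeClassicalPin`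
(the pin (i)/(i'), itself importing only `BettiRealization`, `HodgeFiltration`,
`RationalClassesRingChange`), `HodgeTheory/HodgeConjecture` and `HodgeTheory/HodgeFiltration`.

* `BettiHodgeData.IsClassicalCore B` (`B : BettiHodgeData ℂ`), a `Prop`-valued structure EXTENDING
  the pin `BettiHodgeData.IsClassicalHodge` (`Motives/BettiHodgeClassicalPin`):
  - **(i)/(i') `B.hodge` is the Hodge structure of `X^an`** (inherited fields `comap_hodgePQ`,
    `comap_hodgeFiltration`): for `X` smooth projective of dimension `n`, every Hodge model
    `A : HodgeTheory.HodgeModel n X` and the comparison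
    `Φ_A = B.modelComparison A i : ℂ ⊗_ℚ Hⁱ(X) → ℂ ⊗_ℚ Hⁱ(X(ℂ); ℚ) → Hⁱ(X(ℂ); ℂ) → Hⁱ(X^an; ℂ)`
    (`B.iso ⊗ ℂ`, the change of coefficients `ι = singularCohomology.ringChange (ℚ ↪ ℂ)` extended
    `ℂ`-linearly, the pull-back along `X^an → X(ℂ)`): `V^{p,q} = Φ_A⁻¹(H^{p,q}(X^an))` for
    `p + q = i` and `Fʳ = Φ_A⁻¹(Fʳ Hⁱ(X^an))` (Voisin, *Hodge Theory I*, §6.1.3 Prop. 6.11, §7.1.1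
    Def. 7.4 / Prop. 7.5: `V_ℂ = ⊕ V^{p,q}`, `Fᵖ V_ℂ = ⊕_{r ≥ p} V^{r,k-r}`; Deligne 2000, §1).
  - **(ii-a) cycle classes are supported on their cycles** (`restrictCompl_cycleClass`): for `z` of
    codimension `p` on a smooth projective `X`, `B.iso (cl(z̄)) ∈ H²ᵖ(X(ℂ); ℚ)` restricts to `0` on
    `(X ∖ z̄)(ℂ)` — the class `[Z]` of `Z = z̄` is by definition `j_Z(T⁻¹(1))`, the image of a class
    of `H²ᵖ(X, X ∖ Z)` (Voisin I, §11.1.2), hence dies in `H²ᵖ(X ∖ Z)` by exactness of the sequence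
    of the pair (Voisin I, proof of Lemma 11.13; Fulton, *Intersection Theory*, §19.1).
* `PeriodRealization.IsClassicalCore P` (`P : PeriodRealization k`): `P.B.IsClassicalCore`.
* Proved API (`namespace BettiHodgeData.IsClassicalCore`): the pin API is inherited through
  `IsClassicalCore.toIsClassicalHodge` (membership forms `mem_piece_iff`, `mem_F_iff`,
  `ofRat_mem_piece_iff`, `mem_hodgeClasses_iff_isOfHodgeType`, `mem_hodgeClasses_iff_isInHodgeFiltration`
  of `Motives/BettiHodgeClassicalPin`, reachable by dot notation from `h : B.IsClassicalCore`);
  `ringChange_restrictCompl` (change of coefficients commutes with restriction to `(X ∖ Z)(ℂ)`);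
  **`ringChange_isoObj_cycleClass_mem`**: Betti cycle classes lie in
  `HodgeTheory.algebraicClasses X p = Nᵖ H²ᵖ(X(ℂ); ℂ)`; `ringChange_isoObj_mem_algebraicClasses`
  (hence so does the image of `ℚ · Aᵖ(X)`); the BRIDGE **`IsClassicalCore.hodgeConjectureFor`**:
  `(∀ p, B.HodgeConjectureFor hX p) → HodgeTheory.HodgeConjectureFor n X` for a classical-core `B`,
  given a Hodge model of `X`; `PeriodRealization.IsClassicalCore.hodgeConjectureFor`, its form for
  `X₀ ×_σ ℂ`; `IsClassicalCore.of_isClassicalHodge`, `isClassicalCore_iff`.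
* In `Motives/PeriodRealizationClassical` (which imports this file): `IsClassical.core :
  B.IsClassical → B.IsClassicalCore`, `IsClassical.of_core` (core + (ii-b) is `IsClassical`),
  `isClassical_iff_core`, `PeriodRealization.IsClassical.core`, and the `ofRatClass` spellings.

## The two spellings of the change of coefficients (why nothing had to move)

The request asked for the `ofRatClass` API of `HodgeTheory/RealStructureSingular` (`coeffClass`,
`ofRatClass`, `ofRatClass_π`, `isRationalClass_iff_mem_range_ofRatClass`, `ofRatClass_injective`) to
be re-homed in a binder-free light module. That light module already exists in the `ringChange`
spelling, with an import cone free of unproved named facts, and the two spellings agree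
DEFINITIONALLY (`ofRatClass Y k a` and `singularCohomology.ringChange (algebraMap ℚ ℂ) Y k a` are
both the class of the cocycle `σ ↦ (ζ σ : ℂ)`; `HodgeTheory.ofRatClass_eq_ringChange`,
`Motives.ofRatClassBaseChange_eq_ringChangeBaseChange : … := rfl`):

| `RealStructureSingular` (heavy)              | light home                                                        |
|----------------------------------------------|-------------------------------------------------------------------|
| `coeffClass g k`                             | `singularCohomology.ringChange f Y k` (`SingularHomology/CohomologyRingChange`) |
| `ofRatClass Y k`, `ofRatClass_π`             | `singularCohomology.ringChange (algebraMap ℚ ℂ) Y k`, `singularCohomology.ringChange_π` |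
| `isRationalClass_iff_mem_range_ofRatClass`   | `isRationalClass_iff_exists_ringChange`, `setOf_isRationalClass_eq_range` (`HodgeTheory/RationalClassesRingChange`) |
| `ofRatClass_injective`                       | `ringChange_rat_injective` (same file)                            |
| `ofRatClass_map` (`PeriodRealizationClassical`) | `ringChange_rat_map` (this file)                                |
| `ofRatClassBaseChange`, `complexComparison`, `hodgeModelComparison` | `ringChangeBaseChange`, `BettiHodgeData.comparison`, `BettiHodgeData.modelComparison` (`Motives/BettiHodgeClassicalPin`) |

A declaration cannot change files atomically through the gate (one target per proposal; the
fully-qualified names would clash), so this file is written in the `ringChange` spelling throughout;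
`PeriodRealizationClassical` records the `ofRatClass` forms as definitional corollaries.

## Scope — what the core pins and what it does NOT

* PINNED: `B.hodge` (as in the pin) and the supports of prime-cycle classes. NOT here: (ii-b) — the
  extension of `B` to a `BettiCycleData` (integral structure, orientations, integral cycle classes;
  `Motives/BettiCycleClass`, heavy cone) stays the extra clause of `BettiHodgeData.IsClassical`.
* NOT here either (the request's optional "v2"): a clause (iii) pinning `P.dR` / `P.iso σ` to
  Grothendieck's algebraic de Rham cohomology with its Hodge filtration and comparison isomorphism
  (Grothendieck 1966, Thm. 1'), and a classicality clause for crystalline Frobenius data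
  (Berthelot–Ogus). The tree constructs neither algebraic de Rham cohomology of smooth projective
  schemes (`DeRhamRealization` is itself a hypothesis structure) nor the Berthelot–Ogus Frobenius, so
  there is nothing to pin against today; `P.iso_fil` does transport the pin (i') of the Hodge
  filtration to `P.dR.fil ⊗_{k,σ} ℂ`. These remain construction items.
* `comap` (preimage), not `map`; `∀ A : HodgeModel n X`: as in the pin (module docstring of
  `Motives/BettiHodgeClassicalPin`).
* No instance is constructed here or anywhere in the tree: exhibiting the classical datum is a
  separate construction item (`∃ P, P.IsClassicalCore`); consumers state `∀ P, P.IsClassicalCore → …`.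

## References

* C. Voisin, *Hodge Theory and Complex Algebraic Geometry I*, CUP 2002, §6.1.3 (Prop. 6.11),
  §7.1.1 (Def. 7.4, Prop. 7.5), §11.1.2 (`[Z] = j_Z(T⁻¹(1))`, Lemma 11.13).
* P. Deligne, *The Hodge conjecture*, Clay Mathematics Institute (2000), §1.
* W. Fulton, *Intersection Theory*, 2nd ed. (1998), §19.1.
* A. Hatcher, *Algebraic Topology*, CUP 2002, §3.1 p. 198 (change of coefficients).
* A. Grothendieck, *On the de Rham cohomology of algebraic varieties*, Publ. Math. IHÉS 29 (1966),
  Thm. 1'.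
-/

open CategoryTheory AlgebraicGeometry Opposite
open scoped TensorProduct

noncomputable section

universe u

namespace Literature.AlgebraicGeometry.Motives

open Literature.AlgebraicTopology.SingularHomology Literature.AlgebraicGeometry.HodgeTheory

/-! ### The change of coefficients `ℚ → ℂ` is natural in the space -/

section RingChange

variable {Y Y' : Type u} [TopologicalSpace Y] [TopologicalSpace Y'] (k : ℕ)

/-- **Change of coefficients `ℚ → ℂ` commutes with pull-backs**: for `f : Y' → Y` continuous,
`ι (f^* a) = f^* (ι a)`, `ι = singularCohomology.ringChange (ℚ ↪ ℂ)` (both are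
`u ↦ (ℚ ↪ ℂ) ∘ u ∘ f_♯` on cochains; Hatcher 2002, §3.1 p. 198: a homomorphism of coefficient groups
induces a cochain map, natural in the space). The `ringChange` spelling of `Motives.ofRatClass_map`.
[cite: HatcherAT2002, §3.1 p. 198] -/
theorem ringChange_rat_map (f : C(Y', Y)) (a : singularCohomology ℚ ℚ Y k) :
    singularCohomology.ringChange (algebraMap ℚ ℂ) Y' k (singularCohomology.map ℚ ℚ f k a) =
      singularCohomology.map ℂ ℂ f k (singularCohomology.ringChange (algebraMap ℚ ℂ) Y k a) := by
  induction a using singularCohomology_induction_on with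
  | h u =>
    rw [singularCohomology.map_π, singularCohomology.ringChange_π, singularCohomology.ringChange_π,
      singularCohomology.map_π]
    congr 1
    refine coFn_injective ?_
    rw [coFn_cocyclesRingChange, coFn_cocyclesMap, coFn_cocyclesMap, coFn_cocyclesRingChange]
    funext σ
    rfl

end RingChange

namespace BettiHodgeData

/-! ### Change of coefficients and restriction to open complements -/

section Restrict

variable {k : Type} [Field k] [Algebra k ℂ] (X : SchemeOver k) (Z : Set X.left) (i : ℕ)

/-- The change of coefficients `ℚ → ℂ` commutes with the restriction to the complex points of an
open complement: `ι (a|_{(X ∖ Z)(ℂ)}) = (ι a)|_{(X ∖ Z)(ℂ)}` (`bettiCohomology.restrictCompl` with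
`ℚ`-coefficients, `complexBetti.restrictCompl` with `ℂ`-coefficients — both induced by the inclusion
`(X ∖ Z)(ℂ) ↪ X(ℂ)`). [cite: HatcherAT2002, §3.1 p. 198] -/
theorem ringChange_restrictCompl (a : bettiCohomology X i) :
    singularCohomology.ringChange (algebraMap ℚ ℂ) (complexPointsCompl X Z) i
        (bettiCohomology.restrictCompl X Z i a) =
      singularCohomology.map ℂ ℂ
        (⟨Subtype.val, continuous_subtype_val⟩ : C(complexPointsCompl X Z, ComplexPoints X)) i
        (singularCohomology.ringChange (algebraMap ℚ ℂ) (ComplexPoints X) i a) :=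
  ringChange_rat_map i _ a

end Restrict

variable (B : BettiHodgeData ℂ) {n : ℕ} {X : SchemeOver ℂ}

/-! ### The predicate -/

/-- **`B` is classical at its core** (hypothesis predicate; clauses (i)/(i')/(ii-a) of
`BettiHodgeData.IsClassical`, light-weight home): (i)/(i') — the pin `IsClassicalHodge`, which this
structure extends — for every smooth projective `X`, every Hodge model `A` of `X`, the Hodge pieces
`V^{p,q}` (`p + q = i`) and the Hodge filtration `Fʳ` of `B.hodge hX i` on `Hⁱ(X) ≅ Hⁱ(X(ℂ); ℚ)` are
the preimages of `H^{p,q}(X^an)` and `Fʳ Hⁱ(X^an)` under `Φ_A = B.modelComparison A i :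
ℂ ⊗_ℚ Hⁱ(X) → Hⁱ(X^an; ℂ)` — `B.hodge` IS the Hodge structure of the compact Kähler manifold `X^an`
(Voisin I, §6.1.3 Prop. 6.11, §7.1.1 Def. 7.4; Deligne 2000, §1); (ii-a) the Betti class of a prime
cycle `z̄` of codimension `p` vanishes on `(X ∖ z̄)(ℂ)` (it is `j_Z(T⁻¹(1))`, the image of a class of
`H²ᵖ(X, X ∖ z̄)`: Voisin I, §11.1.2; Fulton 1998, §19.1). Not included: (ii-b), the extension to
`BettiCycleData` (stays in `IsClassical`). No instance exists in the tree; bridge facts are stated as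
`B.IsClassicalCore → …`. [cite: VoisinHodgeI2002, §7.1.1 Def. 7.4 and §11.1.2] -/
structure IsClassicalCore (B : BettiHodgeData ℂ) : Prop extends IsClassicalHodge B where
  /-- (ii-a) The Betti class of the prime cycle `z̄`, `codim z = p`, on a smooth projective `X`
  vanishes on `(X ∖ z̄)(ℂ)` (Voisin I, §11.1.2: `[Z] = j_Z(T⁻¹(1))` comes from `H^{2p}(X, X ∖ Z)`). -/
  restrictCompl_cycleClass : ∀ ⦃n : ℕ⦄ ⦃X : SchemeOver ℂ⦄ (_hX : IsSmoothProjective n X) (p : ℕ)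
    (z : X.left), Order.coheight z = p →
      bettiCohomology.restrictCompl X (closure {z}) (2 * p) (B.isoObj X (2 * p) (B.W.cycleClass X p z))
        = 0

variable {B}

/-- The pin together with clause (ii-a) is the classical core. [cite: VoisinHodgeI2002, §7.1.1 and §11.1.2] -/
theorem IsClassicalCore.of_isClassicalHodge (h : B.IsClassicalHodge)
    (h₂ : ∀ ⦃n : ℕ⦄ ⦃X : SchemeOver ℂ⦄ (_hX : IsSmoothProjective n X) (p : ℕ) (z : X.left),
      Order.coheight z = p →
        bettiCohomology.restrictCompl X (closure {z}) (2 * p)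
          (B.isoObj X (2 * p) (B.W.cycleClass X p z)) = 0) :
    B.IsClassicalCore :=
  ⟨h, h₂⟩

variable (B) in
/-- `IsClassicalCore ↔ IsClassicalHodge ∧ (ii-a)`. [folklore] -/
theorem isClassicalCore_iff :
    B.IsClassicalCore ↔ B.IsClassicalHodge ∧
      ∀ ⦃n : ℕ⦄ ⦃X : SchemeOver ℂ⦄ (_hX : IsSmoothProjective n X) (p : ℕ) (z : X.left),
        Order.coheight z = p →
          bettiCohomology.restrictCompl X (closure {z}) (2 * p)
            (B.isoObj X (2 * p) (B.W.cycleClass X p z)) = 0 :=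
  ⟨fun h ↦ ⟨h.toIsClassicalHodge, h.restrictCompl_cycleClass⟩, fun ⟨h₁, h₂⟩ ↦ ⟨h₁, h₂⟩⟩

namespace IsClassicalCore

/-! ### Cycle classes of a classical-core datum are algebraic classes on the real carrier -/

/-- **Betti cycle classes of a classical-core datum are algebraic classes on the real carrier**: for
a point `z` of codimension `p` on a smooth projective `X`, `ι(B.iso (cl(z̄))) ∈ Nᵖ H²ᵖ(X(ℂ); ℂ) =
HodgeTheory.algebraicClasses X p` (from (ii-a): it dies on `(X ∖ z̄)(ℂ)` — change of coefficients
commutes with restriction — and every point of `z̄` has codimension `≥ p`; Voisin I, §11.1.2;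
Fulton §19.1). The `ringChange` spelling of `IsClassical.ofRatClass_isoObj_cycleClass_mem`.
[cite: VoisinHodgeI2002, §11.1.2] -/
theorem ringChange_isoObj_cycleClass_mem (h : B.IsClassicalCore) (hX : IsSmoothProjective n X)
    {p : ℕ} {z : X.left} (hz : Order.coheight z = p) :
    singularCohomology.ringChange (algebraMap ℚ ℂ) (ComplexPoints X) (2 * p)
        (B.isoObj X (2 * p) (B.W.cycleClass X p z)) ∈ algebraicClasses X p := by
  refine mem_supportedClasses_of_restrictCompl_eq_zero (Z := closure {z}) isClosed_closure
    (fun z' hz' ↦ ?_) ?_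
  · rw [← hz]
    exact Order.coheight_anti (Scheme.le_iff_specializes.2 (specializes_iff_mem_closure.2 hz'))
  · change singularCohomology.map ℂ ℂ _ (2 * p) (singularCohomology.ringChange _ _ _ _) = 0
    rw [← ringChange_restrictCompl, h.restrictCompl_cycleClass hX p z hz, map_zero]

/-- Hence the whole `ℚ`-span of cycle classes maps into the algebraic classes of the real carrier:
`v ∈ ℚ · Aᵖ(X)` implies `ι(B.iso v) ∈ HodgeTheory.algebraicClasses X p`.
[cite: VoisinHodgeI2002, §11.1.2] -/
theorem ringChange_isoObj_mem_algebraicClasses (h : B.IsClassicalCore) (hX : IsSmoothProjective n X)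
    {p : ℕ} {v : B.W.obj X (2 * p)} (hv : v ∈ B.W.algebraicClasses X p) :
    singularCohomology.ringChange (algebraMap ℚ ℂ) (ComplexPoints X) (2 * p) (B.isoObj X (2 * p) v) ∈
      algebraicClasses X p := by
  induction hv using Submodule.span_induction with
  | mem x hx =>
    rw [SetLike.mem_coe] at hx
    unfold PreWeilCohomology.algebraicLattice at hx
    induction hx using AddSubgroup.closure_induction with
    | mem y hy =>
      obtain ⟨⟨z, hz⟩, rfl⟩ := hy
      exact h.ringChange_isoObj_cycleClass_mem hX hz
    | zero => rw [map_zero, map_zero]; exact zero_mem _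
    | add x y _ _ hx hy => rw [map_add, map_add]; exact add_mem hx hy
    | neg x _ hx => rw [map_neg, map_neg]; exact neg_mem hx
  | zero => rw [map_zero, map_zero]; exact zero_mem _
  | add x y _ _ hx hy => rw [map_add, map_add]; exact add_mem hx hy
  | smul q x _ hx =>
    rw [map_smul, ringChange_ratCast_smul]
    exact Submodule.smul_mem _ _ hx

/-! ### The bridge to the Hodge conjecture on the real carriers -/

/-- **Bridge.** For a classical-core Betti–Hodge datum, the `B`-relative Hodge conjecture for `X`
(`B.HodgeConjectureFor hX p`: `ℚ · Aᵖ(X) = Hdgᵖ(X)`, all `p`) implies the Hodge conjecture for `X`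
on the real carriers (`HodgeTheory.HodgeConjectureFor n X`: rational `(p,p)`-classes of
`H²ᵖ(X(ℂ); ℂ)` are algebraic), given a Hodge model of `X` (`hA`; Serre GAGA + de Rham + Hodge).
Proof: a rational class is `ι(B.iso v)` (`isRationalClass_iff_exists_ringChange`); of type `(p,p)`
means `v ∈ Hdgᵖ` by the pin (i); `= ℚ · Aᵖ(X)` by hypothesis; its image is algebraic by (ii-a).
Deligne 2000, §1: Hodge classes `= H²ᵖ(X, ℚ) ∩ H^{p,p}(X)`; "any Hodge class is a rational linear
combination of classes `cl(Z)` of algebraic cycles". The light-cone form of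
`IsClassical.hodgeConjectureFor`. [cite: Deligne2000, §1] -/
theorem hodgeConjectureFor (h : B.IsClassicalCore) (hX : IsSmoothProjective n X)
    (hA : Nonempty (HodgeModel n X)) (hHC : ∀ p : ℕ, B.HodgeConjectureFor hX p) :
    HodgeTheory.HodgeConjectureFor n X := by
  refine ⟨hA, fun p c hc hpp ↦ ?_⟩
  obtain ⟨a, rfl⟩ := (isRationalClass_iff_exists_ringChange c).1 hc
  obtain ⟨v, rfl⟩ : ∃ v, B.isoObj X (2 * p) v = a :=
    ⟨(B.isoObj X (2 * p)).symm a, LinearEquiv.apply_symm_apply _ _⟩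
  have hv : v ∈ (B.hodge hX (2 * p)).hodgeClasses p :=
    (h.mem_hodgeClasses_iff_isOfHodgeType hX hA p v).2 hpp
  rw [← hHC p] at hv
  exact h.ringChange_isoObj_mem_algebraicClasses hX hv

end IsClassicalCore

end BettiHodgeData

/-! ### Classical-core period realizations -/

namespace PeriodRealization

variable {k : Type} [Field k] [CharZero k]

/-- **`P` is classical at its core** (hypothesis predicate): its Betti–Hodge datum `P.B` satisfies
`BettiHodgeData.IsClassicalCore` (Hodge structures = Hodge decomposition of `X^an`, cycle classes
supported on their cycles). Clause (iii) — `P.dR` = algebraic de Rham cohomology with its Hodge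
filtration (Grothendieck 1966, Thm. 1') and `P.iso σ` = Grothendieck's comparison — is NOT part of
it: the tree constructs neither (module docstring, "Scope"). Consumers (route `AdelicCoherence`)
state `∀ P, P.IsClassicalCore → …`; `PeriodRealization.IsClassical` implies it
(`PeriodRealization.IsClassical.core`, `Motives/PeriodRealizationClassical`).
[cite: Grothendieck1966, Thm. 1'] -/
structure IsClassicalCore (P : PeriodRealization k) : Prop where
  /-- The Betti–Hodge datum of `P` is classical at its core. -/
  betti : P.B.IsClassicalCore

/-- A classical-core period realization satisfies the pin. [folklore] -/
theorem IsClassicalCore.isClassicalHodge {P : PeriodRealization k} (h : P.IsClassicalCore) :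
    P.B.IsClassicalHodge :=
  h.betti.toIsClassicalHodge

/-- **Bridge for `k`-definable varieties**: for a classical-core period realization, an embedding
`σ : k →+* ℂ` and `X₀/k` with `X = X₀ ×_σ ℂ` smooth projective of dimension `n`, the `P.B`-relative
Hodge conjecture for `X` (all `p`) implies `HodgeTheory.HodgeConjectureFor n X`, given a Hodge model
of `X`. [cite: Deligne2000, §1] -/
theorem IsClassicalCore.hodgeConjectureFor {P : PeriodRealization k} (h : P.IsClassicalCore)
    (σ : k →+* ℂ) {n : ℕ} {X₀ : SchemeOver k} (hX : IsSmoothProjective n ((baseChangeHom σ).obj X₀))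
    (hA : Nonempty (HodgeModel n ((baseChangeHom σ).obj X₀)))
    (hHC : ∀ p : ℕ, P.B.HodgeConjectureFor hX p) :
    HodgeTheory.HodgeConjectureFor n ((baseChangeHom σ).obj X₀) :=
  h.betti.hodgeConjectureFor hX hA hHC

end PeriodRealization

end Literature.AlgebraicGeometry.Motives

end
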